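import Literature.MathematicalPhysics.QuantumLattice.HubbardTTPrimeGrandCanonicalThermalStates
import Literature.MathematicalPhysics.QuantumLattice.HubbardTTPrimeChemicalPotentialBand
import Literature.MathematicalPhysics.QuantumLattice.SpinSectorPartitionFnParticleHole
import HarnessLib

/-!
# Thermal grand-canonical states of the 2D `t–t'` Hubbard model, II: the density is interior, attains the
# Legendre transform, and lies in an explicit window — equivalence of ensembles at the level of STATES

Family `hubbard` (topic `MathematicalPhysics/QuantumLattice`). Continuation of
`HubbardTTPrimeGrandCanonicalThermalStates` (torus limits `ω` of the grand-canonical Gibbs states of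
`K_L(t,t',U,μ,h) = H_L − μN − hM`; the Griffiths bracket `βρ(ω)(μ₁ − μ) ≤ P(μ₁,h) − P(μ,h)`,
`P = gcPressureTT'Zeeman`) and of the NUMBER files `HubbardTTPrimeGrandCanonical{Pressure,PressureZeeman,EnsembleEquivalence}`,
`HubbardTTPrimeChemicalPotentialBand` (`p(n) = inf_μ [P(μ) − βμn]`, the `T > 0` chemical-potential band of an ATTAINED
pair `(μ, n)`). Here the attained pair is produced by the STATE:

* §1 NUMBERS. (i) `P(β;μ₁) ≤ p(β;0) + 2e^{−λ}` whenever `β(μ₁ + 4|t| + 4|t'|) ≤ −λ`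
  (`gcPressureTT'_le_pressureTT'_zero_add_exp`: the density leg `p(n) ≤ p(0) + 2H_b(n/2) + β(4|t|+4|t'|)n` of
  `HubbardTTPrimeThermalPressureDensityBand` and `H_b(x) − λx ≤ e^{−λ}`), and `P(β;μ,h) ≤ P(β;μ + |h|)`
  (`gcPressureTT'Zeeman_le_gcPressureTT'_add_abs`); (ii) `p(β;0) < P(β;μ,h)` STRICTLY
  (`pressureTT'_zero_lt_gcPressureTT'[Zeeman]`: at density `y = e^{−(β(4|t|+4|t'|+U+|μ|)+1)}` the entropy
  `2H_b(y/2) ≥ y log(1/y)` beats every linear cost); (iii) **PARTICLE–HOLE SYMMETRY OF THE ZEEMAN GRAND-CANONICAL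
  PARTITION FUNCTION AND PRESSURE**: `Re Z_β(K_L(t,t',U,μ,h)) = e^{βL²(2μ−U)} Re Z_β(K_L(t,−t',U,U−μ,−h))` on even tori
  (`partitionFn_gcTorusHamiltonianTT'_re_particleHole`, summing `partitionFn_spinSector_hubbardTorusTT'_particleHole_re`
  against the sector weights and re-indexing `a ↦ L² − a`), hence
  `P(β;t,t',U;μ,h) = β(2μ − U) + P(β;t,−t',U;U−μ,−h)` (`gcPressureTT'Zeeman_particleHole`);
  (iv) **every subgradient of `μ ↦ P(μ,h)` lies in `(0, 2)`** for `β > 0`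
  (`pos_of_forall_mul_sub_le_gcPressureTT'Zeeman_sub`: else `P(·,h)` is constant on `(−∞,μ]`, against (i)+(ii);
  `lt_two_…`: particle–hole symmetry turns `2 − c` into a subgradient of the reflected pressure).
* §2 STATES (`β > 0`, `U ≥ 0`; `ω` thermal grand-canonical at `(β; t,t',U; μ,h)` along `Ls → ∞`):
  **`0 < ρ(ω) < 2`** for every field `h` (`IsTorusLimitOfMixture.density_pos/_lt_two_of_gcGibbs`); at `h = 0`
  **THE DENSITY OF THE STATE ATTAINS THE LEGENDRE TRANSFORM**, `p(β; ρ(ω)) + βμρ(ω) = P(β; μ)`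
  (`….pressureTT'_add_eq_gcPressureTT'_of_gcGibbs` — equivalence of ensembles for states: the canonical pressure of record
  AT THE STATE'S OWN DENSITY plus `βμρ` is the grand-canonical pressure), so `μ` lies in the `T > 0` band of `ρ(ω)`
  (`….chemicalPotential_mem_band_of_gcGibbs`: `log(ρ/(2−ρ)) − β(4|t|+4|t'|) ≤ βμ ≤ log(ρ/(2−ρ)) + β(4|t|+4|t'|+U)`),
  i.e. **THE HYPOTHESIS-FREE DENSITY WINDOW** `2e^a/(1+e^a) ≤ ρ(ω) ≤ 2e^b/(1+e^b)`,
  `a = βμ − β(4|t|+4|t'|+U)`, `b = βμ + β(4|t|+4|t'|)` (`….density_mem_Icc_logistic_of_gcGibbs`: the ideal lattice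
  gas displaced by one bandwidth, plus `U` below); and the `T = 0` grand-canonical variational floor by name at EVERY
  `μ₁` (`….gcEnergyDensityTT'_le_meanEnergy_sub_of_gcGibbs`).

Reading for the oracle: a `μ`-keyed thermal grand-canonical word is placed on the density axis of a phase map
WITHOUT any certificate by `density_mem_Icc_logistic_of_gcGibbs`, and sharpened by three certified pressures via
`density_mem_Icc_of_gc_bounds_of_gcGibbs` of the companion file. Everything is PROVED; no definition, no named fact,
no sorry. WHAT THIS IS NOT: the spin-resolved statement at `h ≠ 0` (`p₂(ρ↑,ρ↓)` attained — needs interiority of each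
`ρ_σ`; not here); uniqueness of the density at given `μ` (first-order transitions are not excluded: the window, not a
value); a number of record.

## Mathlib / tree search

`lean search 'gcPressureTT.*particleHole|gcPressureTT.*_pos|density_pos.*Gibbs'`: nothing for the grand-canonical
number or states (2026-08-27); the canonical number's symmetry is `pressureTT'_particleHole`
(`HubbardTTPrimeThermalPressureParticleHole`). REUSED: `pressureTT'_sub_binEntropy_sub_ge_local/_le_local`
(`HubbardTTPrimeThermalPressureDensityBand`), `gcPressureTT'_le_iff_pressureTT'`, `pressureTT'_eq_iInf_gcPressureTT'`
(`HubbardTTPrimeGrandCanonicalEnsembleEquivalence`), `pressureTT'_add_le_gcPressureTT'`, `pressureTT'₂_add_le_gcPressureTT'`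
(`HubbardTTPrimeGrandCanonicalPressure`), `gcPressureTT'Zeeman_le_iff`, `gcPressureTT'Zeeman_zero(_le)`,
`partitionFn_sub_sub_re_eq_sum` (`…PressureZeeman`), `chemicalPotential_mem_band` (`HubbardTTPrimeChemicalPotentialBand`),
`partitionFn_spinSector_hubbardTorusTT'_particleHole_re` (`SpinSectorPartitionFnParticleHole`), `partitionFn_re_pos`,
`Finset.sum_range_reflect`, `Real.binEntropy`, `Real.one_sub_inv_le_log_of_pos`, and §1–§2 of the companion file.

## References

* D. Ruelle, *Statistical Mechanics: Rigorous Results* (1969), §3.4 (pressure vs density/chemical potential;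
  equivalence of ensembles). [cite: Ruelle1969, §3.4]
* R. B. Israel, *Convexity in the Theory of Lattice Gases* (1979), Thm. I.2.4 (tangent functionals and the
  conjugate variables). [cite: Israel1979, Thm. I.2.4]
* R. B. Griffiths, J. Math. Phys. 5 (1964) 1215 (expectations as one-sided derivatives). [cite: Griffiths1964]
* E. H. Lieb, F. Y. Wu, Physica A 321 (2003) 1, §1 eq. (3) (particle–hole transformation of the Hubbard model).
  [cite: LiebWuPhysicaA2003, §1 eq. (3)]
-/

noncomputable section

namespace Literature.MathematicalPhysics.QuantumLattice

open Matrix Finset HubbardWave0 Literature.Probability.LatticeModels ThermodynamicLimit LiebThm1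
open _root_.Filter
open scoped _root_.Topology ComplexOrder BigOperators
/-! ### §1 The grand-canonical pressure: strictly above its empty-lattice value, decaying to it as `μ → −∞`;
particle–hole symmetry of the number; subgradients in `μ` lie in `(0, 2)` -/

section RealAnalysis

/-- `H_b(x) ≥ x log(1/x)` on `[0,1]` (the second term of the binary entropy is nonnegative). [folklore] -/
private theorem mul_log_inv_le_binEntropy {x : ℝ} (hx0 : 0 ≤ x) (hx1 : x ≤ 1) :
    x * Real.log x⁻¹ ≤ Real.binEntropy x := by
  rw [Real.binEntropy]
  have h : 0 ≤ (1 - x) * Real.log (1 - x)⁻¹ := by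
    rcases hx1.lt_or_eq with hlt | heq
    · exact mul_nonneg (by linarith) (Real.log_nonneg (one_le_inv_iff₀.2 ⟨by linarith, by linarith⟩))
    · rw [heq, sub_self, zero_mul]
  linarith

/-- `H_b(x) ≤ x log(1/x) + x` on `[0,1]` (`−(1−x)log(1−x) ≤ x`). [folklore] -/
private theorem binEntropy_le_mul_log_inv_add {x : ℝ} (hx1 : x ≤ 1) :
    Real.binEntropy x ≤ x * Real.log x⁻¹ + x := by
  rw [Real.binEntropy]
  have h : (1 - x) * Real.log (1 - x)⁻¹ ≤ x := by
    rcases hx1.lt_or_eq with hlt | heq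
    · have hpos : 0 < 1 - x := by linarith
      rw [Real.log_inv]
      -- `log(1 - x) ≥ 1 - 1/(1 - x)`
      have hlog := Real.one_sub_inv_le_log_of_pos hpos
      have : (1 - x) * (1 - (1 - x)⁻¹) = (1 - x) - 1 := by field_simp
      nlinarith [mul_le_mul_of_nonneg_left hlog hpos.le]
    · rw [heq, sub_self, zero_mul]; linarith
  linarith

/-- `x (a − log x) ≤ e^{a−1}` for `x ≥ 0` (the maximum of `x ↦ x(a − log x)` is at `x = e^{a−1}`). [folklore] -/
private theorem mul_sub_log_le_exp (a : ℝ) {x : ℝ} (hx : 0 ≤ x) : x * (a - Real.log x) ≤ Real.exp (a - 1) := by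
  rcases hx.lt_or_eq with hpos | h0
  · -- `log (x / e^{a-1}) ≥ 1 − e^{a-1}/x`, i.e. `x log x − x(a−1) ≥ x − e^{a−1}`
    have hq : 0 < x / Real.exp (a - 1) := div_pos hpos (Real.exp_pos _)
    have h := Real.one_sub_inv_le_log_of_pos hq
    rw [Real.log_div hpos.ne' (Real.exp_pos _).ne', Real.log_exp, inv_div] at h
    have h2 := mul_le_mul_of_nonneg_left h hpos.le
    have e : x * (1 - Real.exp (a - 1) / x) = x - Real.exp (a - 1) := by field_simp
    rw [e] at h2
    nlinarith
  · rw [← h0, zero_mul]; exact (Real.exp_pos _).le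

/-- **`H_b(x) − λx ≤ e^{−λ}`** on `[0,1]` (the Legendre-type bound used for the `μ → −∞` decay). [folklore] -/
private theorem binEntropy_sub_mul_le_exp_neg (lam : ℝ) {x : ℝ} (hx0 : 0 ≤ x) (hx1 : x ≤ 1) :
    Real.binEntropy x - lam * x ≤ Real.exp (-lam) := by
  have h1 := binEntropy_le_mul_log_inv_add hx1
  have h2 := mul_sub_log_le_exp (1 - lam) hx0
  rw [show (1 - lam - 1 : ℝ) = -lam by ring] at h2
  have e : x * (1 - lam - Real.log x) = x * Real.log x⁻¹ + x - lam * x := by rw [Real.log_inv]; ring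
  linarith

end RealAnalysis

namespace ThermodynamicLimit

section Numbers

variable {β : ℝ} (hβ : 0 ≤ β) (t t' : ℝ) {U : ℝ} (hU : 0 ≤ U)
include hβ hU

/-- **Decay of the grand-canonical pressure as `μ → −∞`**: if `β(μ₁ + 4|t| + 4|t'|) ≤ −λ` then
`P(β; t,t',U; μ₁) ≤ p(β; t,t',U; 0) + 2e^{−λ}` (`p(·;0)` = the empty-lattice value; the density leg
`p(n) ≤ p(0) + 2H_b(n/2) + β(4|t|+4|t'|)n` of `HubbardTTPrimeThermalPressureDensityBand` and `H_b(x) − λx ≤ e^{−λ}`).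
[cite: Ruelle1969, §3.4] -/
theorem gcPressureTT'_le_pressureTT'_zero_add_exp (μ₁ lam : ℝ) (hμ : β * (μ₁ + (4 * |t| + 4 * |t'|)) ≤ -lam) :
    gcPressureTT' β t t' U μ₁ ≤ pressureTT' β t t' U 0 + 2 * Real.exp (-lam) := by
  rw [gcPressureTT'_le_iff_pressureTT' hβ t t' hU]
  intro n hn0 hn2
  have hleg := pressureTT'_sub_binEntropy_sub_le_local hβ t t' hU (x := 0) le_rfl hn0 hn2
  rw [zero_div, Real.binEntropy_zero, mul_zero, sub_zero, sub_zero] at hleg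
  have hH := binEntropy_sub_mul_le_exp_neg lam (x := n / 2) (by linarith) (by linarith)
  have hn : β * (μ₁ + (4 * |t| + 4 * |t'|)) * n ≤ -lam * n := mul_le_mul_of_nonneg_right hμ hn0
  nlinarith

/-- **The Zeeman pressure is dominated by the zero-field pressure at the shifted chemical potential**
`μ + |h|`: `P(β; μ, h) ≤ P(β; μ + |h|)` (`h(x − y) ≤ |h|(x + y)` on the sectors). [cite: Ruelle1969, §3.4] -/
theorem gcPressureTT'Zeeman_le_gcPressureTT'_add_abs (μ hz : ℝ) :
    gcPressureTT'Zeeman β t t' U μ hz ≤ gcPressureTT' β t t' U (μ + |hz|) := by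
  rw [gcPressureTT'Zeeman_le_iff hβ t t' hU]
  intro x y hx0 hx1 hy0 hy1
  have h1 := pressureTT'₂_add_le_gcPressureTT' hβ t t' hU (μ + |hz|) hx0 hx1 hy0 hy1
  have h2 : β * hz * (x - y) ≤ β * |hz| * (x + y) := by
    have ha : hz * (x - y) ≤ |hz| * (x + y) := by
      cases le_or_gt 0 hz with
      | inl h => rw [abs_of_nonneg h]; nlinarith
      | inr h => rw [abs_of_neg h]; nlinarith
    nlinarith
  nlinarith

/-- **The grand-canonical pressure is STRICTLY above the empty-lattice value**: `p(β; 0) < P(β; μ)` for every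
`μ` (`β ≥ 0`, `U ≥ 0`): at the density `y = e^{−(β(4|t|+4|t'|+U+|μ|)+1)}` the entropy `2H_b(y/2) ≥ y log(1/y)`
beats the linear costs. [cite: Ruelle1969, §3.4] [cite: Israel1979, Thm. I.2.4] -/
theorem pressureTT'_zero_lt_gcPressureTT' (μ : ℝ) : pressureTT' β t t' U 0 < gcPressureTT' β t t' U μ := by
  set K : ℝ := β * (4 * |t| + 4 * |t'| + U + |μ|) + 1 with hK
  set y : ℝ := Real.exp (-K) with hy
  have hK0 : 0 < K := by
    have : 0 ≤ β * (4 * |t| + 4 * |t'| + U + |μ|) := by positivity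
    linarith
  have hy0 : 0 < y := Real.exp_pos _
  have hy1 : y ≤ 1 := by rw [hy]; exact Real.exp_le_one_iff.2 (by linarith)
  have hy2 : y < 2 := by linarith
  have hleg := pressureTT'_sub_binEntropy_sub_ge_local hβ t t' hU (x := 0) le_rfl hy0.le hy2
  rw [zero_div, Real.binEntropy_zero, mul_zero, sub_zero, sub_zero] at hleg
  have hP := pressureTT'_add_le_gcPressureTT' hβ t t' hU μ hy0.le hy2
  -- entropy: `2 H_b(y/2) ≥ y log(2/y) ≥ y log(1/y) = y K`
  have hent : y * K ≤ 2 * Real.binEntropy (y / 2) := by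
    have h1 := mul_log_inv_le_binEntropy (x := y / 2) (by linarith) (by linarith)
    have hlogy : Real.log y⁻¹ = K := by rw [hy, Real.log_inv, Real.log_exp, neg_neg]
    have hmono : Real.log y⁻¹ ≤ Real.log (y / 2)⁻¹ :=
      Real.log_le_log (inv_pos.2 hy0) (by rw [inv_div, le_div_iff₀ hy0]; field_simp; linarith)
    nlinarith
  have hμy : -(β * |μ| * y) ≤ β * μ * y := by
    have h := mul_le_mul_of_nonneg_left (neg_abs_le μ) (mul_nonneg hβ hy0.le)
    have e1 : β * y * -|μ| = -(β * |μ| * y) := by ring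
    have e2 : β * y * μ = β * μ * y := by ring
    rw [e1, e2] at h
    exact h
  -- assemble: `p y + βμy ≥ p 0 + y`
  have : pressureTT' β t t' U 0 + y ≤ pressureTT' β t t' U y + β * μ * y := by
    have e : y * K = β * (4 * |t| + 4 * |t'| + U) * y + β * |μ| * y + y := by rw [hK]; ring
    linarith
  linarith

/-- Zeeman form: `p(β; 0) < P(β; μ, h)`. [cite: Ruelle1969, §3.4] -/
theorem pressureTT'_zero_lt_gcPressureTT'Zeeman (μ hz : ℝ) :
    pressureTT' β t t' U 0 < gcPressureTT'Zeeman β t t' U μ hz :=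
  (pressureTT'_zero_lt_gcPressureTT' hβ t t' hU μ).trans_le
    ((gcPressureTT'Zeeman_zero (β := β) (U := U) t t' μ).symm.le.trans (gcPressureTT'Zeeman_zero_le hβ t t' hU μ hz))

/-- **Subgradients of the pressure in `μ` are POSITIVE** (`β > 0`): if `βc(μ₁ − μ) ≤ P(μ₁,h) − P(μ,h)` for
every `μ₁`, then `0 < c` — otherwise `P(·,h)` would be constant on `(−∞, μ]`, contradicting the decay to the
empty-lattice value and `p(0) < P(μ,h)`. [cite: Ruelle1969, §3.4] [cite: Griffiths1964] -/
theorem pos_of_forall_mul_sub_le_gcPressureTT'Zeeman_sub (hβ' : 0 < β) (μ hz : ℝ) {c : ℝ}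
    (hc : ∀ μ₁ : ℝ, β * c * (μ₁ - μ) ≤ gcPressureTT'Zeeman β t t' U μ₁ hz - gcPressureTT'Zeeman β t t' U μ hz) :
    0 < c := by
  by_contra hc0
  push Not at hc0
  set g : ℝ := gcPressureTT'Zeeman β t t' U μ hz - pressureTT' β t t' U 0 with hg
  have hg0 : 0 < g := sub_pos.2 (pressureTT'_zero_lt_gcPressureTT'Zeeman hβ t t' hU μ hz)
  set lam : ℝ := -Real.log (g / 4) with hlam
  have hexp : Real.exp (-lam) = g / 4 := by rw [hlam, neg_neg, Real.exp_log (by positivity)]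
  set μ₁ : ℝ := min μ (-(|hz| + (4 * |t| + 4 * |t'|)) - lam / β) with hμ₁
  have hμ₁μ : μ₁ ≤ μ := min_le_left _ _
  have hμ₁' : β * ((μ₁ + |hz|) + (4 * |t| + 4 * |t'|)) ≤ -lam := by
    have h2 : μ₁ ≤ -(|hz| + (4 * |t| + 4 * |t'|)) - lam / β := min_le_right _ _
    have h3 : μ₁ + |hz| + (4 * |t| + 4 * |t'|) ≤ -(lam / β) := by linarith
    calc β * ((μ₁ + |hz|) + (4 * |t| + 4 * |t'|)) ≤ β * (-(lam / β)) :=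
          mul_le_mul_of_nonneg_left (by linarith) hβ'.le
      _ = -lam := by field_simp
  have hup := (gcPressureTT'Zeeman_le_gcPressureTT'_add_abs hβ t t' hU μ₁ hz).trans
    (gcPressureTT'_le_pressureTT'_zero_add_exp hβ t t' hU (μ₁ + |hz|) lam hμ₁')
  rw [hexp] at hup
  have hlow := hc μ₁
  have hsign : 0 ≤ β * c * (μ₁ - μ) := by
    have : β * c ≤ 0 := mul_nonpos_of_nonneg_of_nonpos hβ'.le hc0
    nlinarith
  linarith

end Numbers

/-! #### Particle–hole symmetry of the Zeeman grand-canonical partition function and pressure -/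

section ParticleHole

/-- **Particle–hole symmetry of the Zeeman grand-canonical partition function of an EVEN torus**:
`Re Z_β(K_L(t,t',U,μ,h)) = e^{βL²(2μ − U)} · Re Z_β(K_L(t,−t',U,U − μ,−h))` — sum the sector identity
`Z(a,b; t') = e^{βU(L² − a − b)} Z(L² − a, L² − b; −t')` (`partitionFn_spinSector_hubbardTorusTT'_particleHole_re`)
against the weights `e^{β(μ(a+b) + h(a−b))}` and re-index `a ↦ L² − a`. [cite: LiebWuPhysicaA2003, §1 eq. (3)]
[cite: Ruelle1969, §3.4] -/
theorem partitionFn_gcTorusHamiltonianTT'_re_particleHole {L : ℕ} (hL : Even L) (β t t' U μ hz : ℝ) :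
    (partitionFn β (gcTorusHamiltonianTT' L t t' U μ hz)).re =
      Real.exp (β * (2 * μ - U) * (L : ℝ) ^ 2) *
        (partitionFn β (gcTorusHamiltonianTT' L t (-t') U (U - μ) (-hz))).re := by
  have hP : ∀ s : ℝ, PreservesSectors (hubbardTorusTT' L t s U) := fun s => by
    unfold hubbardTorusTT'
    exact (preservesSectors_hamiltonian _ t U).add (preservesSectors_hamiltonian _ s 0)
  have hc : Fintype.card (FermionTorus 2 L) = L ^ 2 := by simp [FermionTorus, sq]
  set N := L ^ 2 with hN
  have h₁ : (partitionFn β (gcTorusHamiltonianTT' L t t' U μ hz)).re =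
      ∑ a ∈ Finset.range (N + 1), ∑ b ∈ Finset.range (N + 1),
        Real.exp (β * μ * (a + b) + β * hz * (a - b)) *
          (partitionFn β (spinSectorHamiltonian a b (hubbardTorusTT' L t t' U))).re := by
    rw [gcTorusHamiltonianTT', ← hc]
    convert partitionFn_sub_sub_re_eq_sum (hP t') β μ hz using 4
  have h₂ : (partitionFn β (gcTorusHamiltonianTT' L t (-t') U (U - μ) (-hz))).re =
      ∑ a ∈ Finset.range (N + 1), ∑ b ∈ Finset.range (N + 1),
        Real.exp (β * (U - μ) * (a + b) + β * (-hz) * (a - b)) *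
          (partitionFn β (spinSectorHamiltonian a b (hubbardTorusTT' L t (-t') U))).re := by
    rw [gcTorusHamiltonianTT', ← hc]
    convert partitionFn_sub_sub_re_eq_sum (hP (-t')) β (U - μ) (-hz) using 4
  rw [h₁, h₂, Finset.mul_sum]
  -- reflect the outer sum `a ↦ N − a` and the inner sum `b ↦ N − b`
  rw [← Finset.sum_range_reflect _ (N + 1)]
  refine Finset.sum_congr rfl fun a ha => ?_
  rw [Finset.mul_sum, ← Finset.sum_range_reflect _ (N + 1)]
  refine Finset.sum_congr rfl fun b hb => ?_
  have haN : a ≤ N := Nat.lt_succ_iff.1 (Finset.mem_range.1 ha)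
  have hbN : b ≤ N := Nat.lt_succ_iff.1 (Finset.mem_range.1 hb)
  have ea : N + 1 - 1 - a = N - a := by omega
  have eb : N + 1 - 1 - b = N - b := by omega
  rw [ea, eb]
  have hpa : (N - a) + a = L ^ 2 := by omega
  have hpb : (N - b) + b = L ^ 2 := by omega
  rw [partitionFn_spinSector_hubbardTorusTT'_particleHole_re hL β t t' U hpa hpb, ← mul_assoc, ← mul_assoc,
    ← Real.exp_add, ← Real.exp_add]
  congr 2
  have hNa : ((N - a : ℕ) : ℝ) = (N : ℝ) - a := by rw [Nat.cast_sub haN]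
  have hNb : ((N - b : ℕ) : ℝ) = (N : ℝ) - b := by rw [Nat.cast_sub hbN]
  rw [hNa, hNb, hN]
  push_cast
  ring

variable {β : ℝ} (hβ : 0 ≤ β) (t t' : ℝ) {U : ℝ} (hU : 0 ≤ U)
include hβ hU

/-- **Particle–hole symmetry of the Zeeman grand-canonical pressure**:
`P(β; t,t',U; μ, h) = β(2μ − U) + P(β; t,−t',U; U − μ, −h)` (`β ≥ 0`, `U ≥ 0`; the finite-volume identity
along the even tori, both sides converging by `tendsto_log_partitionFn_gcTorus_div_sq_comp`).
[cite: LiebWuPhysicaA2003, §1 eq. (3)] [cite: Ruelle1969, §3.4] -/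
theorem gcPressureTT'Zeeman_particleHole (μ hz : ℝ) :
    gcPressureTT'Zeeman β t t' U μ hz = β * (2 * μ - U) + gcPressureTT'Zeeman β t (-t') U (U - μ) (-hz) := by
  set Ls : ℕ → ℕ := fun j => 2 * (j + 1) with hLs_def
  have hLs : Tendsto Ls atTop atTop := by
    refine tendsto_atTop_atTop.2 fun b => ⟨b, fun j hj => ?_⟩
    show b ≤ 2 * (j + 1)
    omega
  have h1 := tendsto_log_partitionFn_gcTorus_div_sq_comp hβ t t' hU μ hz hLs
  have h2 := tendsto_log_partitionFn_gcTorus_div_sq_comp hβ t (-t') hU (U - μ) (-hz) hLs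
  refine tendsto_nhds_unique h1 ((h2.const_add (β * (2 * μ - U))).congr fun j => ?_)
  have hev : Even (Ls j) := ⟨j + 1, by rw [hLs_def]; ring⟩
  have hL1 : (0 : ℝ) < ((Ls j : ℕ) : ℝ) ^ 2 := by
    have : (1 : ℝ) ≤ ((Ls j : ℕ) : ℝ) := by
      have : 1 ≤ Ls j := by show 1 ≤ 2 * (j + 1); omega
      exact_mod_cast this
    positivity
  have hZpos : 0 < (partitionFn β (gcTorusHamiltonianTT' (Ls j) t (-t') U (U - μ) (-hz))).re :=
    partitionFn_re_pos (gcTorusHamiltonianTT'_isHermitian (Ls j) t (-t') U (U - μ) (-hz)) β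
  rw [partitionFn_gcTorusHamiltonianTT'_re_particleHole hev β t t' U μ hz, Real.log_mul (Real.exp_pos _).ne' hZpos.ne',
    Real.log_exp, add_div, mul_div_assoc, div_self hL1.ne', mul_one]

/-- **Subgradients of the pressure in `μ` are BELOW `2`** (`β > 0`): if `βc(μ₁ − μ) ≤ P(μ₁,h) − P(μ,h)` for every
`μ₁`, then `c < 2` (particle–hole symmetry turns `2 − c` into a subgradient of the reflected pressure, which is
positive). [cite: Ruelle1969, §3.4] [cite: Griffiths1964] -/
theorem lt_two_of_forall_mul_sub_le_gcPressureTT'Zeeman_sub (hβ' : 0 < β) (μ hz : ℝ) {c : ℝ}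
    (hc : ∀ μ₁ : ℝ, β * c * (μ₁ - μ) ≤ gcPressureTT'Zeeman β t t' U μ₁ hz - gcPressureTT'Zeeman β t t' U μ hz) :
    c < 2 := by
  have h := pos_of_forall_mul_sub_le_gcPressureTT'Zeeman_sub hβ t (-t') hU hβ' (U - μ) (-hz) (c := 2 - c)
    fun ν₁ => by
      have h1 := hc (U - ν₁)
      rw [gcPressureTT'Zeeman_particleHole hβ t t' hU (U - ν₁) hz, gcPressureTT'Zeeman_particleHole hβ t t' hU μ hz,
        show U - (U - ν₁) = ν₁ by ring] at h1
      nlinarith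
  linarith

end ParticleHole

end ThermodynamicLimit

/-! ### §2 Ensemble equivalence at the level of STATES: the density of a thermal grand-canonical state is
interior, attains the Legendre transform, and lies in an explicit window -/

namespace InfVolFermionState

section Ensembles

variable {β : ℝ} (hβ : 0 ≤ β) (t t' : ℝ) {U : ℝ} (hU : 0 ≤ U) (μ hz : ℝ)
  {ω : InfVolFermionState 2} {Ls : ℕ → ℕ}
include hβ hU

/-- **The density of a thermal grand-canonical state is strictly positive** (`β > 0`, any field).
[cite: Ruelle1969, §3.4] [cite: Griffiths1964] -/
theorem IsTorusLimitOfMixture.density_pos_of_gcGibbs (hβ' : 0 < β)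
    (hω : ω.IsTorusLimitOfMixture sourcedGibbsCount (gcGibbsWeightTT' β t t' U μ hz)
      (gcGibbsVectorTT' t t' U μ hz) Ls)
    (hLs : Tendsto Ls atTop atTop) : 0 < ω.density :=
  ThermodynamicLimit.pos_of_forall_mul_sub_le_gcPressureTT'Zeeman_sub hβ t t' hU hβ' μ hz
    fun μ₁ => hω.mul_density_mul_sub_le_gcPressureTT'Zeeman_sub_of_gcGibbs hβ t t' hU μ hz hLs μ₁

/-- **The density of a thermal grand-canonical state is strictly below `2`** (`β > 0`, any field).
[cite: Ruelle1969, §3.4] [cite: Griffiths1964] -/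
theorem IsTorusLimitOfMixture.density_lt_two_of_gcGibbs (hβ' : 0 < β)
    (hω : ω.IsTorusLimitOfMixture sourcedGibbsCount (gcGibbsWeightTT' β t t' U μ hz)
      (gcGibbsVectorTT' t t' U μ hz) Ls)
    (hLs : Tendsto Ls atTop atTop) : ω.density < 2 :=
  ThermodynamicLimit.lt_two_of_forall_mul_sub_le_gcPressureTT'Zeeman_sub hβ t t' hU hβ' μ hz
    fun μ₁ => hω.mul_density_mul_sub_le_gcPressureTT'Zeeman_sub_of_gcGibbs hβ t t' hU μ hz hLs μ₁

/-- **ENSEMBLE EQUIVALENCE AT THE STATE LEVEL** (zero field, `β > 0`, `U ≥ 0`): the density `ρ(ω)` of every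
thermal grand-canonical state at chemical potential `μ` ATTAINS the Legendre transform,
`p(β; ρ(ω)) + βμρ(ω) = P(β; μ)` — the canonical pressure at the state's own density plus `βμρ` is the
grand-canonical pressure (`≤` for every density; `≥` from `p(n) = inf_μ₁ [P(μ₁) − βμ₁n]` and the subgradient
inequality). [cite: Ruelle1969, §3.4] [cite: Israel1979, Thm. I.2.4] -/
theorem IsTorusLimitOfMixture.pressureTT'_add_eq_gcPressureTT'_of_gcGibbs (hβ' : 0 < β)
    (hω : ω.IsTorusLimitOfMixture sourcedGibbsCount (gcGibbsWeightTT' β t t' U μ 0)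
      (gcGibbsVectorTT' t t' U μ 0) Ls)
    (hLs : Tendsto Ls atTop atTop) :
    pressureTT' β t t' U ω.density + β * μ * ω.density = gcPressureTT' β t t' U μ := by
  have hρ0 := hω.density_pos_of_gcGibbs hβ t t' hU μ 0 hβ' hLs
  have hρ2 := hω.density_lt_two_of_gcGibbs hβ t t' hU μ 0 hβ' hLs
  refine le_antisymm (pressureTT'_add_le_gcPressureTT' hβ t t' hU μ hρ0.le hρ2) ?_
  have hsub : ∀ μ₁ : ℝ, β * ω.density * (μ₁ - μ) ≤ gcPressureTT' β t t' U μ₁ - gcPressureTT' β t t' U μ := by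
    intro μ₁
    have h := hω.mul_density_mul_sub_le_gcPressureTT'Zeeman_sub_of_gcGibbs hβ t t' hU μ 0 hLs μ₁
    rwa [gcPressureTT'Zeeman_zero (β := β) (U := U) t t', gcPressureTT'Zeeman_zero (β := β) (U := U) t t'] at h
  have hinf : gcPressureTT' β t t' U μ - β * μ * ω.density ≤ pressureTT' β t t' U ω.density := by
    rw [pressureTT'_eq_iInf_gcPressureTT' hβ t t' hU hβ' hρ0 hρ2]
    refine le_ciInf fun μ₁ => ?_
    have h := hsub μ₁
    nlinarith
  linarith

/-- **The chemical potential lies in the `T > 0` band of the state's own density** (zero field, `β > 0`):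
`log(ρ/(2−ρ)) − β(4|t|+4|t'|) ≤ βμ ≤ log(ρ/(2−ρ)) + β(4|t|+4|t'|+U)`, `ρ = ρ(ω)`
(`chemicalPotential_mem_band` at the attained pair). [cite: Ruelle1969, §3.4] [cite: Israel1979, Thm. I.2.4] -/
theorem IsTorusLimitOfMixture.chemicalPotential_mem_band_of_gcGibbs (hβ' : 0 < β)
    (hω : ω.IsTorusLimitOfMixture sourcedGibbsCount (gcGibbsWeightTT' β t t' U μ 0)
      (gcGibbsVectorTT' t t' U μ 0) Ls)
    (hLs : Tendsto Ls atTop atTop) :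
    Real.log (ω.density / (2 - ω.density)) - β * (4 * |t| + 4 * |t'|) ≤ β * μ ∧
      β * μ ≤ Real.log (ω.density / (2 - ω.density)) + β * (4 * |t| + 4 * |t'| + U) :=
  chemicalPotential_mem_band hβ t t' hU (hω.density_pos_of_gcGibbs hβ t t' hU μ 0 hβ' hLs)
    (hω.density_lt_two_of_gcGibbs hβ t t' hU μ 0 hβ' hLs)
    (hω.pressureTT'_add_eq_gcPressureTT'_of_gcGibbs hβ t t' hU μ hβ' hLs)

/-- **THE HYPOTHESIS-FREE DENSITY WINDOW OF A THERMAL GRAND-CANONICAL STATE** (zero field, `β > 0`, `U ≥ 0`):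
with `a = βμ − β(4|t|+4|t'|+U)` and `b = βμ + β(4|t|+4|t'|)`,
`2e^a/(1 + e^a) ≤ ρ(ω) ≤ 2e^b/(1 + e^b)` — the ideal lattice gas shifted by one bandwidth (plus `U` below).
[cite: Ruelle1969, §3.4] [cite: Israel1979, Thm. I.2.4] -/
theorem IsTorusLimitOfMixture.density_mem_Icc_logistic_of_gcGibbs (hβ' : 0 < β)
    (hω : ω.IsTorusLimitOfMixture sourcedGibbsCount (gcGibbsWeightTT' β t t' U μ 0)
      (gcGibbsVectorTT' t t' U μ 0) Ls)
    (hLs : Tendsto Ls atTop atTop) :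
    ω.density ∈ Set.Icc
      (2 * Real.exp (β * μ - β * (4 * |t| + 4 * |t'| + U)) / (1 + Real.exp (β * μ - β * (4 * |t| + 4 * |t'| + U))))
      (2 * Real.exp (β * μ + β * (4 * |t| + 4 * |t'|)) / (1 + Real.exp (β * μ + β * (4 * |t| + 4 * |t'|)))) := by
  have hρ0 := hω.density_pos_of_gcGibbs hβ t t' hU μ 0 hβ' hLs
  have hρ2 := hω.density_lt_two_of_gcGibbs hβ t t' hU μ 0 hβ' hLs
  obtain ⟨hlo, hhi⟩ := hω.chemicalPotential_mem_band_of_gcGibbs hβ t t' hU μ hβ' hLs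
  set ρ := ω.density with hρ
  have hq : 0 < ρ / (2 - ρ) := div_pos hρ0 (by linarith)
  have hexp : Real.exp (Real.log (ρ / (2 - ρ))) = ρ / (2 - ρ) := Real.exp_log hq
  constructor
  · -- `e^a ≤ ρ/(2−ρ)` ⇒ `2e^a/(1+e^a) ≤ ρ`
    set A := Real.exp (β * μ - β * (4 * |t| + 4 * |t'| + U)) with hA
    have hA0 : 0 < A := Real.exp_pos _
    have h1 : A ≤ ρ / (2 - ρ) := by
      rw [← hexp, hA]
      exact Real.exp_le_exp.2 (by linarith)
    rw [div_le_iff₀ (by linarith)]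
    have h2 : A * (2 - ρ) ≤ ρ := (le_div_iff₀ (by linarith)).1 h1
    nlinarith
  · set B := Real.exp (β * μ + β * (4 * |t| + 4 * |t'|)) with hB
    have hB0 : 0 < B := Real.exp_pos _
    have h1 : ρ / (2 - ρ) ≤ B := by
      rw [← hexp, hB]
      exact Real.exp_le_exp.2 (by linarith)
    rw [le_div_iff₀ (by linarith)]
    have h2 : ρ ≤ B * (2 - ρ) := (div_le_iff₀ (by linarith)).1 h1
    nlinarith

/-- **`T = 0` grand-canonical variational floor for thermal states by name** (zero field, `β > 0`): since
`0 < ρ(ω) < 2`, the tree's `IsTranslationInvariant.gcEnergyDensityTT'_le_meanEnergy_sub` applies: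
`p₀(μ₁) ≤ e_Φ(ω) − μ₁ρ(ω)` for EVERY `μ₁` (not only the state's own `μ`). [cite: Ruelle1969, §3.4] -/
theorem IsTorusLimitOfMixture.gcEnergyDensityTT'_le_meanEnergy_sub_of_gcGibbs (hβ' : 0 < β)
    (hω : ω.IsTorusLimitOfMixture sourcedGibbsCount (gcGibbsWeightTT' β t t' U μ hz)
      (gcGibbsVectorTT' t t' U μ hz) Ls)
    (hLs : Tendsto Ls atTop atTop) (μ₁ : ℝ) :
    gcEnergyDensityTT' t t' U μ₁ ≤ ω.meanEnergy (hubbardTTPrimeFermionInteraction t t' U) 1 - μ₁ * ω.density :=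
  hω.isTranslationInvariant.gcEnergyDensityTT'_le_meanEnergy_sub t t' hU μ₁
    (hω.density_pos_of_gcGibbs hβ t t' hU μ hz hβ' hLs) (hω.density_lt_two_of_gcGibbs hβ t t' hU μ hz hβ' hLs)

end Ensembles

end InfVolFermionState

end Literature.MathematicalPhysics.QuantumLattice

end
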